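import Mathlib
import HarnessLib
import Summits.Ventures.LatticeQCDFlow.Scoring.WilsonStapleSum
import Summits.Ventures.LatticeQCDFlow.Exactness.PTBCWilsonDefect

/-!
# The weighted staple sum: for ANY plaquette weights the link-local weighted Wilson action is `Re tr (ρ(U_e) R^w_e)` up to a constant, and a one-link update changes `S_w` by `Re tr (ρ(U_e) R^w_e) − Re tr (ρ(hU_e) R^w_e)`

HONEST FRAMING: exact (Metropolis-corrected) sampling algorithms for lattice gauge theory;
figures of merit are autocorrelation/cost numbers at stated couplings and volumes; no
continuum-physics claim.

Venture `LatticeQCDFlow` (cell pub-lqcd), sub-topic `Scoring`; FANOUT row 21 (`su3-base`, arm `OBC-HMC`: open boundary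
conditions are plaquette weights `obcWeight`, `Exactness/OpenBoundaryWilsonAction`; rows 22–24's PTBC defect is the
same object with other weights — the engine `latflow.core.gauge4d`: "the action becomes `S = β Σ_p w_p (1 − Re tr U_p/N)`;
HB/OR/Metropolis/HMC/flow all honour it (staple sums are weighted)").  NEW WORK of the cell over the tree (row 16's
`Scoring/WilsonStapleSum`: `stapleUp`, `stapleDown`, `stapleSum`, `plane`, `plaqOf`, `plaqThrough_eq_image`,
`plaqOf_injective`, `plaqRe_plaqOf_true/false`, `stapleUp/Down_mulSingle_self`; `TrivializingMaps/WilsonLinkLocality`: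
`plaqLinks`, `plaqThrough`, `plaqRe_mulSingle_of_not_mem`; `Exactness/PTBCWilsonDefect`: `weightedWilsonAction w ρ`, which
records as NOT CLAIMED "that HB/OR of the engine with WEIGHTED staples is the exact heat bath for the weighted action").
This file supplies the missing identity behind that sentence: the number every weighted local algorithm computes.
Nothing is cited as a fact; no number.

## What is proved (torus `(ℤ/L)^d`, any group `G`, any `ρ : G →* M_N(ℂ)`, ANY weights `w : Plaquette d L → ℝ`)

* §1 **`weightedStapleSum w ρ U x μ = Σ_{ν ≠ μ} (w(x; μ,ν)·ρ(A_ν) + w(x − ν̂; μ,ν)·ρ(B_ν))`** — each staple carries the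
  weight of ITS plaquette (`plaqOf x μ (ν, upper/lower)`); `weightedStapleSum_one` (unit weights: row 16's `stapleSum`);
  `continuous_weightedStapleSum`.
* §2 (`L ≥ 2`) `weightedStapleSum_mulSingle_self` — `R^w_{x,μ}` does not read the link `(x, μ)`.
* §3 (`L ≥ 2`, compact `G`, continuous `ρ`) **`sum_plaqThrough_weighted_plaqRe`** —
  `Σ_{p ∋ (x,μ)} w_p Re tr ρ(U_p) = Re tr (ρ(U(x,μ)) · R^w_{x,μ}(U))`; `weightedWilsonAction_eq_through_add` (split of `S_w`
  into the plaquettes through `e` and the rest) and `weightedWilsonAction_rest_mulSingle` (the rest does not read `e`);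
  **`weightedWilsonAction_mulSingle_sub`** — THE EXACT LOCAL DIFFERENCE for every weight:
  `S_w(h ·_e U) − S_w(U) = Re tr (ρ(U_e) R^w_e) − Re tr (ρ(h U_e) R^w_e)` with the SAME `R^w_e = R^w_e(U)`.

Consequences (sequels, not here): the weighted over-relaxation hit conserving `Re tr (g R^w)` is exact for
`e^{−S_w}·Haar^⊗`; weighted Cabibbo–Marinari cooling never increases `S_w`; the weighted loop sum of the HMC force is
`U_e R^w_e`.  NOT CLAIMED: `L = 1`; non-compact `G`; improved actions; anything probabilistic; any number.
-/

noncomputable section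

open Matrix
open Literature.MathematicalPhysics.QuantumFieldTheory
open Literature.RepresentationTheory.CompactGroups (CompactGroup.re_trace_map_inv CompactGroup.trace_conj_eq)
open Summit.Ventures.LatticeQCDFlow.TrivializingMaps (plaqLinks plaqThrough mem_plaqLinks_iff mem_plaqThrough_iff
  plaqRe_mulSingle_of_not_mem)
open Summit.Ventures.LatticeQCDFlow.Exactness (weightedWilsonAction)

namespace Summit.Ventures.LatticeQCDFlow.Scoring

variable {d L N : ℕ} {G : Type*} [Group G] (w : Plaquette d L → ℝ) (ρ : G →* Matrix (Fin N) (Fin N) ℂ)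

/-! ## §1 The weighted staple-sum matrix -/

section Def

/-- **The weighted staple sum** of the link `(x, μ)`: `R^w_{x,μ}(U) = Σ_{ν ≠ μ} (w_{upper}·ρ(A_ν) + w_{lower}·ρ(B_ν))`,
each staple weighted by the weight of its own plaquette (`plaqOf x μ (ν, true)` based at `x`, `plaqOf x μ (ν, false)`
based at `x − ν̂`). -/
def weightedStapleSum (U : GaugeConfig d L G) (x : Site d L) (μ : Fin d) : Matrix (Fin N) (Fin N) ℂ :=
  ∑ ν : {ν : Fin d // ν ≠ μ}, (w (plaqOf x μ (ν, true)) • ρ (stapleUp U x μ ν) +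
    w (plaqOf x μ (ν, false)) • ρ (stapleDown U x μ ν))

/-- **Unit weights give row 16's staple sum**: `R^1 = R`. -/
theorem weightedStapleSum_one (U : GaugeConfig d L G) (x : Site d L) (μ : Fin d) :
    weightedStapleSum (fun _ : Plaquette d L => (1 : ℝ)) ρ U x μ = stapleSum ρ U x μ := by
  rw [weightedStapleSum, stapleSum_def]
  simp only [one_smul]
  exact (Finset.sum_subtype (Finset.univ.erase μ) (p := fun ν => ν ≠ μ)
    (fun ν => by rw [Finset.mem_erase, and_iff_left (Finset.mem_univ ν)])
    (fun ν => ρ (stapleUp U x μ ν) + ρ (stapleDown U x μ ν))).symm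

variable [TopologicalSpace G] [IsTopologicalGroup G]

/-- The weighted staple sum is continuous in the configuration (continuous `ρ`). -/
theorem continuous_weightedStapleSum (hρ : Continuous ρ) (x : Site d L) (μ : Fin d) :
    Continuous fun U : GaugeConfig d L G => weightedStapleSum w ρ U x μ := by
  unfold weightedStapleSum
  refine continuous_finsetSum _ fun ν _ => ?_
  have h1 : Continuous fun U : GaugeConfig d L G => ρ (stapleUp U x μ ν) :=
    hρ.comp (by unfold stapleUp; fun_prop)
  have h2 : Continuous fun U : GaugeConfig d L G => ρ (stapleDown U x μ ν) :=
    hρ.comp (by unfold stapleDown; fun_prop)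
  exact (h1.const_smul (w (plaqOf x μ (ν, true)))).add (h2.const_smul (w (plaqOf x μ (ν, false))))

end Def

/-! ## §2 The weighted staple sum does not read its own link (`L ≥ 2`) -/

section Fibre

variable [NeZero L]

/-- `R^w_{x,μ}(h ·_{(x,μ)} U) = R^w_{x,μ}(U)` for every weight (`L ≥ 2`). -/
theorem weightedStapleSum_mulSingle_self (hL : 2 ≤ L) (U : GaugeConfig d L G) (x : Site d L) (μ : Fin d) (h : G) :
    weightedStapleSum w ρ (Pi.mulSingle (x, μ) h * U) x μ = weightedStapleSum w ρ U x μ := by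
  refine Finset.sum_congr rfl fun ν _ => ?_
  rw [stapleUp_mulSingle_self hL U x ν.2, stapleDown_mulSingle_self hL U x ν.2]

end Fibre

/-! ## §3 The weighted link action in staple form and the exact local difference -/

section Through

variable [NeZero L]

/-- `S_w` splits into the plaquettes through `e` and the rest. -/
theorem weightedWilsonAction_eq_through_add (e : Edge d L) (U : GaugeConfig d L G) :
    weightedWilsonAction w ρ U = (∑ p ∈ plaqThrough e, w p * ((N : ℝ) - WilsonRP.plaqRe ρ U p)) +
      ∑ p ∈ Finset.univ.filter (fun p : Plaquette d L => e ∉ plaqLinks p), w p * ((N : ℝ) - WilsonRP.plaqRe ρ U p) := by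
  have h : weightedWilsonAction w ρ U = ∑ p : Plaquette d L, w p * ((N : ℝ) - WilsonRP.plaqRe ρ U p) := rfl
  rw [h, plaqThrough]
  exact (Finset.sum_filter_add_sum_filter_not Finset.univ (fun p : Plaquette d L => e ∈ plaqLinks p)
    (fun p => w p * ((N : ℝ) - WilsonRP.plaqRe ρ U p))).symm

/-- The rest does not read the link `e`: it is constant along the `e`-fibre. -/
theorem weightedWilsonAction_rest_mulSingle (e : Edge d L) (h : G) (U : GaugeConfig d L G) :
    ∑ p ∈ Finset.univ.filter (fun p : Plaquette d L => e ∉ plaqLinks p),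
        w p * ((N : ℝ) - WilsonRP.plaqRe ρ (Pi.mulSingle e h * U) p) =
      ∑ p ∈ Finset.univ.filter (fun p : Plaquette d L => e ∉ plaqLinks p), w p * ((N : ℝ) - WilsonRP.plaqRe ρ U p) := by
  refine Finset.sum_congr rfl fun p hp => ?_
  rw [plaqRe_mulSingle_of_not_mem ρ (Finset.mem_filter.1 hp).2]

variable [TopologicalSpace G] [IsTopologicalGroup G] [CompactSpace G]

/-- **The weighted link action in staple form**: for `L ≥ 2`, compact `G`, continuous `ρ` and every weight,
`Σ_{p ∋ (x,μ)} w_p Re tr ρ(U_p) = Re tr (ρ(U(x,μ)) · R^w_{x,μ}(U))`. -/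
theorem sum_plaqThrough_weighted_plaqRe (hL : 2 ≤ L) (hρ : Continuous ρ) (U : GaugeConfig d L G) (x : Site d L) (μ : Fin d) :
    ∑ p ∈ plaqThrough (x, μ), w p * WilsonRP.plaqRe ρ U p = ((ρ (U (x, μ)) * weightedStapleSum w ρ U x μ).trace).re := by
  rw [plaqThrough_eq_image, Finset.sum_image fun a _ b _ h => plaqOf_injective hL x μ h, Fintype.sum_prod_type]
  simp_rw [Fintype.sum_bool, plaqRe_plaqOf_true ρ hρ, plaqRe_plaqOf_false ρ hρ]
  rw [weightedStapleSum, Finset.mul_sum, Matrix.trace_sum, Complex.re_sum]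
  refine Finset.sum_congr rfl fun ν _ => ?_
  rw [Matrix.mul_add, Matrix.mul_smul, Matrix.mul_smul, Matrix.trace_add, Matrix.trace_smul, Matrix.trace_smul,
    Complex.add_re, Complex.smul_re, Complex.smul_re, smul_eq_mul, smul_eq_mul]

/-- **THE EXACT LOCAL DIFFERENCE FOR EVERY PLAQUETTE WEIGHT.**  Replacing the link `U(x,μ)` by `h · U(x,μ)` changes the
weighted Wilson action by `S_w(h ·_e U) − S_w(U) = Re tr (ρ(U_e) R^w_e) − Re tr (ρ(h U_e) R^w_e)` with the SAME weighted
staple sum `R^w_e = R^w_e(U)` — the number the engine's weighted heat bath, over-relaxation, Metropolis and cooling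
compute (`L ≥ 2`, compact `G`, continuous `ρ`; open boundaries and the PTBC defect included). -/
theorem weightedWilsonAction_mulSingle_sub (hL : 2 ≤ L) (hρ : Continuous ρ) (U : GaugeConfig d L G) (x : Site d L)
    (μ : Fin d) (h : G) :
    weightedWilsonAction w ρ (Pi.mulSingle (x, μ) h * U) - weightedWilsonAction w ρ U =
      ((ρ (U (x, μ)) * weightedStapleSum w ρ U x μ).trace).re -
        ((ρ (h * U (x, μ)) * weightedStapleSum w ρ U x μ).trace).re := by
  have hsplit : ∀ V : GaugeConfig d L G, ∑ p ∈ plaqThrough (x, μ), w p * ((N : ℝ) - WilsonRP.plaqRe ρ V p) =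
      (∑ p ∈ plaqThrough (x, μ), w p * (N : ℝ)) - ∑ p ∈ plaqThrough (x, μ), w p * WilsonRP.plaqRe ρ V p := fun V => by
    rw [← Finset.sum_sub_distrib]
    exact Finset.sum_congr rfl fun p _ => by ring
  have e1 := weightedWilsonAction_eq_through_add w ρ (x, μ) (Pi.mulSingle (x, μ) h * U)
  have e2 := weightedWilsonAction_eq_through_add w ρ (x, μ) U
  have e3 := weightedWilsonAction_rest_mulSingle w ρ ((x, μ) : Edge d L) h U
  have e4 := sum_plaqThrough_weighted_plaqRe w ρ hL hρ (Pi.mulSingle (x, μ) h * U) x μ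
  have e5 := sum_plaqThrough_weighted_plaqRe w ρ hL hρ U x μ
  rw [weightedStapleSum_mulSingle_self w ρ hL, mulSingle_mul_apply_self] at e4
  rw [hsplit] at e1 e2
  linarith

end Through

end Summit.Ventures.LatticeQCDFlow.Scoring

/-! ## §4 (appended) Translating the configuration translates the weighted staple sum and moves the weights

Appended section (GEN-5 of row 21): the LOCAL companion of `OpenBoundaryTimeReflection.weightedWilsonAction_configTranslate_eq`
(`S_w(T_v U) = S_{w(−v+·)}(U)`): `R^w_{x,μ}(T_v U) = R^{w(−v+·)}_{v+x,μ}(U)` — what a weighted local update (over-relaxation,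
cooling, the open-boundary force) computes on a translated field is the update at the translated link with translated weights.
-/

namespace Summit.Ventures.LatticeQCDFlow.Scoring

open Summit.Ventures.LatticeQCDFlow.Exactness (configTranslate configTranslate_apply edgeTranslate_apply)

section Translate

variable {d L N : ℕ} {G : Type*} [Group G] [MeasurableSpace G] (w : Plaquette d L → ℝ) (ρ : G →* Matrix (Fin N) (Fin N) ℂ)
  (v : Site d L)

/-- The upper staple of the translated configuration: `A_ν(T_v U; x, μ) = A_ν(U; v + x, μ)`. -/
theorem stapleUp_configTranslate (U : GaugeConfig d L G) (x : Site d L) (μ ν : Fin d) :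
    stapleUp (configTranslate v U) x μ ν = stapleUp U (v + x) μ ν := by
  simp only [stapleUp, configTranslate_apply, Function.comp_apply, edgeTranslate_apply, Site.shift, add_assoc]

/-- The lower staple of the translated configuration: `B_ν(T_v U; x, μ) = B_ν(U; v + x, μ)`. -/
theorem stapleDown_configTranslate (U : GaugeConfig d L G) (x : Site d L) (μ ν : Fin d) :
    stapleDown (configTranslate v U) x μ ν = stapleDown U (v + x) μ ν := by
  simp only [stapleDown, configTranslate_apply, Function.comp_apply, edgeTranslate_apply, Site.shift, add_assoc,
    add_sub_assoc]

/-- The plaquette through `(v + x, μ)` labelled `(ν, b)` is the translate of the one through `(x, μ)`: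
`−v + (plaqOf (v + x) μ (ν, b)).1 = (plaqOf x μ (ν, b)).1`, same plane. -/
theorem plaqOf_translate (x : Site d L) (μ : Fin d) (νb : {ν : Fin d // ν ≠ μ} × Bool) :
    ((-v + (plaqOf (v + x) μ νb).1, (plaqOf (v + x) μ νb).2) : Plaquette d L) = plaqOf x μ νb := by
  obtain ⟨ν, b⟩ := νb
  cases b <;> simp only [plaqOf, Bool.false_eq_true, ↓reduceIte] <;> (ext1 <;> [abel; rfl])

/-- **`R^w_{x,μ}(T_v U) = R^{w(−v + ·)}_{v + x, μ}(U)`**: the weighted staple sum of the translated field is the weighted staple sum at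
the translated link, with the weights read through the translation. -/
theorem weightedStapleSum_configTranslate (U : GaugeConfig d L G) (x : Site d L) (μ : Fin d) :
    weightedStapleSum w ρ (configTranslate v U) x μ =
      weightedStapleSum (fun q : Plaquette d L => w (-v + q.1, q.2)) ρ U (v + x) μ := by
  unfold weightedStapleSum
  refine Finset.sum_congr rfl fun νb _ => ?_
  rw [stapleUp_configTranslate, stapleDown_configTranslate]
  beta_reduce
  rw [plaqOf_translate, plaqOf_translate]

end Translate

end Summit.Ventures.LatticeQCDFlow.Scoring
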